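import Mathlib

/-!
# SoloBlind — invertibility of the coupled column operator from the dressed scalar (ENGINE P v0.3)

On a pair box the streak matrix `T_s` may be singular, so `1 - L` is not the right object; the coupled
operator is `𝒯 = (T̂ - K') - c • e_k e_kᵀ` with `T̂ = T_s + c e_k e_kᵀ` the site-shifted streak matrix.
Engine L⁺ certifies that `M := T̂ - K'` is invertible and engine P certifies that the dressed scalar
`𝔇 = 1 - c · (M⁻¹)_{kk}` has no zero on the needed region.  This file proves the algebra
(matrix determinant lemma):

* `det_sub_rank_one`    : `det (M - c • eₖeₖᵀ) = det M · (1 - c · M⁻¹ k k)` for invertible `M`;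
* `isUnit_sub_rank_one` : `IsUnit M → 1 - c · M⁻¹ k k ≠ 0 → IsUnit (M - c • eₖeₖᵀ)`.

Here `eₖeₖᵀ = vecMulVec (Pi.single k 1) (Pi.single k 1)`.
-/

namespace Summit.AnomalousDissipation.SoloBlind.CoupledShermanMorrison

open Matrix

variable {n : Type*} [Fintype n] [DecidableEq n]

/-- Matrix determinant lemma for `1 + a bᵀ`. -/
theorem det_one_add_vecMulVec (a b : n → ℂ) : (1 + vecMulVec a b).det = 1 + b ⬝ᵥ a := by
  rw [vecMulVec_eq Unit, det_one_add_replicateCol_mul_replicateRow]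

omit [DecidableEq n] in
/-- `M (a bᵀ) = (M a) bᵀ`. -/
theorem mul_vecMulVec (M : Matrix n n ℂ) (a b : n → ℂ) :
    M * vecMulVec a b = vecMulVec (M *ᵥ a) b := by
  ext i j
  simp only [mul_apply, vecMulVec_apply, mulVec, dotProduct, Finset.sum_mul]
  exact Finset.sum_congr rfl fun x _ => by ring

/-- `det (M - c • eₖ eₖᵀ) = det M · (1 - c · (M⁻¹) k k)` when `M` is invertible. -/
theorem det_sub_rank_one (M : Matrix n n ℂ) (hM : IsUnit M) (c : ℂ) (k : n) :
    (M - c • vecMulVec (Pi.single k 1) (Pi.single k 1)).det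
      = M.det * (1 - c * (M⁻¹) k k) := by
  have hdet : IsUnit M.det := (isUnit_iff_isUnit_det M).mp hM
  set e : n → ℂ := Pi.single k 1 with he
  set a : n → ℂ := -(c • (M⁻¹ *ᵥ e)) with ha
  have hMa : M *ᵥ a = -(c • e) := by
    rw [ha, mulVec_neg, mulVec_smul, mulVec_mulVec, mul_nonsing_inv _ hdet, one_mulVec]
  have hfac : M - c • vecMulVec e e = M * (1 + vecMulVec a e) := by
    rw [mul_add, mul_one, mul_vecMulVec, hMa]
    have : vecMulVec (-(c • e)) e = -(c • vecMulVec e e) := by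
      ext i j; simp [vecMulVec_apply]; ring
    rw [this, sub_eq_add_neg]
  rw [hfac, det_mul, det_one_add_vecMulVec]
  congr 1
  have hdot : e ⬝ᵥ a = -(c * (M⁻¹) k k) := by
    rw [ha, dotProduct_neg, dotProduct_smul, smul_eq_mul, he, single_one_dotProduct, mulVec_single_one]
    rfl
  rw [hdot]; ring

/-- Invertibility of the coupled operator from `𝔇 = 1 - c (M⁻¹)ₖₖ ≠ 0`. -/
theorem isUnit_sub_rank_one (M : Matrix n n ℂ) (hM : IsUnit M) (c : ℂ) (k : n)
    (hD : 1 - c * (M⁻¹) k k ≠ 0) :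
    IsUnit (M - c • vecMulVec (Pi.single k 1) (Pi.single k 1)) := by
  rw [isUnit_iff_isUnit_det, det_sub_rank_one M hM c k]
  exact (((isUnit_iff_isUnit_det M).mp hM).mul (isUnit_iff_ne_zero.mpr hD))

end Summit.AnomalousDissipation.SoloBlind.CoupledShermanMorrison
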